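import Mathlib
import Literature.NumberTheory.Automorphic.FuchsianUnfoldingBounded
import Literature.NumberTheory.Automorphic.FuchsianEisensteinTruncation
import Literature.NumberTheory.Automorphic.FuchsianCuspFormsCompact
import Literature.NumberTheory.Automorphic.EisensteinOrthogonality
import Literature.NumberTheory.Automorphic.EisensteinSpectralProjection

/-!
# Functions of the height in a cusp: the isometry `L²((log Y, ∞)) → L²(Γ\\ℍ)`, unfolding against `L²`, and orthogonality
(Iwaniec, *Spectral Methods of Automorphic Forms*, GSM 53, §2.2 (2.2)–(2.5), §3.1 (3.2), §3.2
(3.12)–(3.16), Lemma 3.3 (3.14), §4.2 (4.12), §6.4 (6.29) (truncation by constant terms), §7.3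
(orthogonality of the Eisenstein spaces of inequivalent cusps); PDF pp. 30–31, 40–44, 51, 75, 88)

First brick of an Eisenstein-free proof of the pretrace estimate (12.5)
(`Literature.NumberTheory.Automorphic.Iwaniec2002_eq_12_5`) for a general finite volume group: the
Hilbert-space bookkeeping of the cuspidal zones by which the invariant integral operators will be
split into a compact part and a part acting on functions of the height (a convolution in `log y`).
For a discrete `Γ ≤ SL₂(ℝ)` (inside `GL₂(ℝ)`) with `-1 ∈ Γ`, a measurable fundamental domain `F`, a
cusp `𝔞 = σ∞` with width-one scaling matrix `σ`, and `Y ≥ 1` — everything PROVED, nothing vendored,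
no fact introduced:

1. (§1) **High rows are unique up to sign** (`row_eq_or_eq_neg_of_lt_rowIm`, from Shimizu's
   `|c| ≥ 1`): at a point at most one pair `±(c, d)` of bottom rows of `σ⁻¹Γσ` has height `> Y`;
   hence the **evaluation form** `E_𝔞(z|ψ) = ψ(v_z)` of incomplete Eisenstein series of profiles
   vanishing on `(-∞, Y]` (`exists_incEisCusp_eq_apply`): `ψ ↦ E_𝔞(·|ψ)` is linear, multiplicative,
   and commutes with `|·|²` and `conj` pointwise.
2. (§2) `∫_F |E_𝔞(z|ψ)|² dμ = ∫_0^∞ |ψ(y)|² y⁻² dy` as Lebesgue integrals, for measurable `ψ`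
   (`lintegral_enorm_sq_incEisCusp`; unfolding of non-negative functions, no integrability needed).
3. (§3) the log-height profiles `liftProfile Y Ψ (y) = 𝟙_{y>Y} √y Ψ(log y)`, the cusp lift
   `cuspLift σ Y Ψ = E_𝔞(·|liftProfile Y Ψ)` with `∫_F |·|² = ∫_{log Y}^∞ |Ψ|²`, and the
   **linear isometry `cuspIsometry : L²((log Y, ∞)) →ₗᵢ L²(F)`** (`V_𝔞`; classes of cusp lifts).
4. (§4) **Lemma 3.3 for `L²` data** (`setIntegral_incEisCusp_mul_of_memLp`:
   `∫_F E_𝔞(·|φ) g = ∫ φ(y) y⁻² (g^Γ)_𝔞(y) dy` for `g ∈ L²(F)`, `∫|φ|²y⁻² < ∞`; Cauchy–Schwarz on the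
   strip, where `g^Γ ∘ σ` carries at most the mass of `F`), periodicity and continuity of constant
   terms, and `cuspMeanAt_eq_zero_of_orthogonal`: a continuous automorphic `G` orthogonal to all
   `E_𝔞(·|φ)`, `φ ∈ C_c((Y, ∞))`, has `G_𝔞 ≡ 0` above `Y` (the pointwise form of "truncation kills the
   constant terms", (6.29)).
5. (§5) for a system of inequivalent cusps: the cusp lifts at different cusps have disjoint
   supports (`cuspLift_mul_cuspLift_eq_zero_of_ne`), so the `V_𝔞` have pairwise orthogonal ranges
   (`inner_cuspIsometry_eq_zero_of_ne`); the bridge `E_𝔞(·|φ) = V_𝔞(Ψ_φ)`, `Ψ_φ(v) = e^{-v/2}φ(e^v)`.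

## References
* [Iwaniec2002] H. Iwaniec, *Spectral Methods of Automorphic Forms*, 2nd ed., GSM 53, AMS 2002,
  §2.2, PDF pp. 30–31; §3.1–3.2 & Lemma 3.3, PDF pp. 40–44; §4.2 (4.12), PDF p. 51; §6.4 (6.29),
  PDF p. 88; §7.3, PDF p. 75 (held copy `book:iwaniec2002-spectral-methods-automorphic-forms`).

Mathlib: `MeasureTheory.lintegral_image_eq_lintegral_abs_deriv_mul` (`y = e^v`), `MemLp.toLp`,
`LinearIsometry`, `MeasureTheory.L2.inner_def`, `MemLp.integrable_mul` (Cauchy–Schwarz),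
`IsOpen.ae_eq_zero_of_integral_contDiff_smul_eq_zero`,
`intervalIntegral.continuous_parametric_intervalIntegral_of_continuous'`. Literature:
`Fuchsian.incEis`, `incEisCusp`, `rows`, `rowIm`, `rowIm_le_inv_im`, `apply_one_eq_of_mem_rows`,
`stripEquiv`, `tsum_strip_smul_eq_cusp`, `conjEquiv`, `setIntegral_incEisCusp_mul`,
`integral_strip_mul_eq_of_integrable`, `measurable_incEisCusp`, `incEisCusp_frame_eq_zero_of_ne`,
`lintegral_sq_autExt_frameStrip_le`, `setLIntegral_tsum_smul_eq`, `autExt`, `cuspMeanAt`,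
`cuspMean_vadd`, `lintegral_upperHalfPlane_eq`, `setLIntegral_upperHalf_eq_iterated`, `pt`,
`invCoe`, `integral_Ioi_expSubst` (files `FuchsianGroupCusps`, `FuchsianIncompleteEisenstein(Cusp)`,
`FuchsianUnfoldingBounded`, `FuchsianEisensteinTruncation`, `FuchsianCuspFormsCompact`,
`FundamentalDomainUnfolding`, `AutomorphicKernelOperators`, `(Fuchsian)CuspidalSubspace`,
`EisensteinOrthogonality`, `HyperbolicDirichletForm`, `InvariantIntegralOperators`).
-/

noncomputable section

namespace Literature.NumberTheory.Automorphic

open Matrix UpperHalfPlane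
open scoped MatrixGroups

namespace Fuchsian

variable {Γ : Subgroup (GL (Fin 2) ℝ)}

/-! ## 1. High rows are unique up to sign; the evaluation form of `E(z|ψ)` -/

section Rows

open _root_.MeasureTheory _root_.Set _root_.Filter
open scoped _root_.Pointwise _root_.ENNReal _root_.Topology

/-- Rows `(0, c)` act on rows by scaling: `(0, c) · M = c · (row 1 of M)`. [folklore] -/
theorem vecMul_of_apply_zero_eq_zero {ρ : Fin 2 → ℝ} (h0 : ρ 0 = 0) (M : Matrix (Fin 2) (Fin 2) ℝ) :
    Matrix.vecMul ρ M = ρ 1 • M 1 := by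
  ext j
  simp [Matrix.vecMul, dotProduct, Fin.sum_univ_two, h0]

/-- The height of a row is even in the row: `Im_{-r} = Im_r`. [folklore] -/
theorem rowIm_neg (r : Fin 2 → ℝ) (z : ℍ) : rowIm (-r) z = rowIm r z := by
  simp only [rowIm, rowDenom, Pi.neg_apply, Complex.ofReal_neg]
  rw [show -(r 0 : ℂ) * z + -(r 1 : ℂ) = -((r 0 : ℂ) * z + r 1) by ring, Complex.normSq_neg]

/-- The negative of a row of `Γ` is a row of `Γ` when `-1 ∈ Γ`. [folklore] -/
theorem neg_mem_rows (hneg : (-1 : GL (Fin 2) ℝ) ∈ Γ) {r : Fin 2 → ℝ} (hr : r ∈ rows Γ) : -r ∈ rows Γ := by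
  obtain ⟨γ, hγ, rfl⟩ := hr
  refine ⟨-1 * γ, Γ.mul_mem hneg hγ, ?_⟩
  ext j
  simp [Units.val_neg]

/-- **High rows are unique up to sign** (width one at `∞`, `Y ≥ 1`): two bottom rows of `Γ` of
height `> Y` at the same point differ by a sign. (If `γ, γ' ∈ Γ` have these rows then
`Im γz > Y ≥ 1` and the row of `γ'γ⁻¹` has height `> Y` at `γz`; by Shimizu its lower-left entry
vanishes, so `γ'γ⁻¹ = ±T_n` and the rows agree up to sign.)
[cite: Iwaniec2002, proof of Lemma 2.10 & §2.2 (2.3)–(2.5), PDF pp. 30–31, 39] -/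
theorem row_eq_or_eq_neg_of_lt_rowIm
    (hΓ : Γ ≤ (Matrix.SpecialLinearGroup.toGL : SL(2, ℝ) →* GL (Fin 2) ℝ).range)
    (hd : IsDiscreteSubgroup Γ) (hT : Matrix.GeneralLinearGroup.upperRightHom (1 : ℝ) ∈ Γ)
    {Y : ℝ} (hY : 1 ≤ Y) {z : ℍ} {r r' : Fin 2 → ℝ} (hr : r ∈ rows Γ) (hr' : r' ∈ rows Γ)
    (h1 : Y < rowIm r z) (h2 : Y < rowIm r' z) : r' = r ∨ r' = -r := by
  obtain ⟨γ, hγ, rfl⟩ := hr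
  obtain ⟨γ', hγ', rfl⟩ := hr'
  set w : ℍ := γ • z with hw
  have hwim : w.im = rowIm ((γ : Matrix (Fin 2) (Fin 2) ℝ) 1) z := im_smul_eq_rowIm (hΓ hγ) z
  have hwY : Y < w.im := by rw [hwim]; exact h1
  set ρ : Fin 2 → ℝ := ((γ' * γ⁻¹ : GL (Fin 2) ℝ) : Matrix (Fin 2) (Fin 2) ℝ) 1 with hρ
  have hρmem : ρ ∈ rows Γ := row_mem_rows (Γ.mul_mem hγ' (Γ.inv_mem hγ))
  have hρim : rowIm ρ w = rowIm ((γ' : Matrix (Fin 2) (Fin 2) ℝ) 1) z := by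
    rw [hρ, row_mul, rowIm_vecMul (hΓ (Γ.inv_mem hγ)), hw, inv_smul_smul]
  have hρ0 : ρ 0 = 0 := by
    by_contra h0
    have hle := rowIm_le_inv_im hΓ hd hT hρmem h0 w
    rw [hρim] at hle
    have hw0 := w.im_pos
    have : 1 / w.im < Y := by
      rw [div_lt_iff₀ hw0]
      nlinarith
    linarith
  have hρ1 := apply_one_eq_of_mem_rows hΓ hd hT hρmem hρ0
  -- `row γ' = ρ · γ = ρ 1 • row γ`
  have e : ((γ' : GL (Fin 2) ℝ) : Matrix (Fin 2) (Fin 2) ℝ) 1 = ρ 1 • ((γ : GL (Fin 2) ℝ) : Matrix (Fin 2) (Fin 2) ℝ) 1 := by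
    have h := row_mul (γ' * γ⁻¹) γ
    rw [inv_mul_cancel_right] at h
    rw [h, ← hρ, vecMul_of_apply_zero_eq_zero hρ0]
  beta_reduce
  rcases hρ1 with h | h
  · left; rw [e, h, one_smul]
  · right; rw [e, h, _root_.neg_one_smul]

/-- **Evaluation form of `E(z|ψ)`** for profiles vanishing on `(-∞, Y]`, `Y ≥ 1`: at every `z` there
is one height `v` with `E(z|ψ) = ψ(v)` for all such `ψ` (the height of the unique pair of rows of
height `> Y`, or `v = 0` if there is none). [cite: Iwaniec2002, §3.2 (3.12) & (3.16), PDF pp. 43–44] -/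
theorem exists_incEis_eq_apply
    (hΓ : Γ ≤ (Matrix.SpecialLinearGroup.toGL : SL(2, ℝ) →* GL (Fin 2) ℝ).range)
    (hneg : (-1 : GL (Fin 2) ℝ) ∈ Γ) (hd : IsDiscreteSubgroup Γ)
    (hT : Matrix.GeneralLinearGroup.upperRightHom (1 : ℝ) ∈ Γ) {Y : ℝ} (hY : 1 ≤ Y) (z : ℍ) :
    ∃ v : ℝ, (v = 0 ∨ Y < v) ∧ ∀ ψ : ℝ → ℂ, (∀ t ≤ Y, ψ t = 0) → incEis Γ ψ z = ψ v := by
  classical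
  by_cases h : ∃ r ∈ rows Γ, Y < rowIm r z
  · obtain ⟨r₀, hr₀, hr₀Y⟩ := h
    refine ⟨rowIm r₀ z, Or.inr hr₀Y, fun ψ hψ => ?_⟩
    have hr₀ne : r₀ ≠ -r₀ := by
      intro he
      have h0 : r₀ = 0 := by
        have : (2 : ℝ) • r₀ = 0 := by rw [two_smul]; nth_rewrite 2 [he]; exact add_neg_cancel r₀
        exact (smul_eq_zero.mp this).resolve_left two_ne_zero
      exact ne_zero_of_mem_rows hr₀ h0
    set a : rows Γ := ⟨r₀, hr₀⟩ with ha
    set b : rows Γ := ⟨-r₀, neg_mem_rows hneg hr₀⟩ with hb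
    have hab : a ≠ b := fun he => hr₀ne (congrArg Subtype.val he)
    have hsupp : ∀ r : rows Γ, r ∉ ({a, b} : Finset (rows Γ)) → ψ (rowIm r.1 z) = 0 := by
      intro r hr
      apply hψ
      by_contra hlt
      rw [not_le] at hlt
      rcases row_eq_or_eq_neg_of_lt_rowIm hΓ hd hT hY hr₀ r.2 hr₀Y hlt with h1 | h1
      · exact hr (by rw [Finset.mem_insert]; left; exact Subtype.ext h1)
      · exact hr (by rw [Finset.mem_insert, Finset.mem_singleton]; right; exact Subtype.ext h1)
    unfold incEis
    rw [tsum_eq_sum hsupp, Finset.sum_pair hab]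
    simp only [ha, hb, rowIm_neg]
    ring
  · push Not at h
    refine ⟨0, Or.inl rfl, fun ψ hψ => ?_⟩
    rw [hψ 0 (by linarith), incEis_eq_zero_of_forall_rowIm_le (a := Y) hψ h]

/-- The same at the cusp `𝔞 = σ∞` with width-one scaling matrix `σ`. [cite: Iwaniec2002, §3.2 (3.12) & (3.16), PDF pp. 43–44] -/
theorem exists_incEisCusp_eq_apply
    (hΓ : Γ ≤ (Matrix.SpecialLinearGroup.toGL : SL(2, ℝ) →* GL (Fin 2) ℝ).range)
    (hneg : (-1 : GL (Fin 2) ℝ) ∈ Γ) (hd : IsDiscreteSubgroup Γ) (σ : SL(2, ℝ))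
    (hper : (ConjAct.toConjAct (Matrix.SpecialLinearGroup.toGL σ : GL (Fin 2) ℝ)⁻¹ • Γ).strictPeriods =
      AddSubgroup.zmultiples 1)
    {Y : ℝ} (hY : 1 ≤ Y) (z : ℍ) :
    ∃ v : ℝ, (v = 0 ∨ Y < v) ∧ ∀ ψ : ℝ → ℂ, (∀ t ≤ Y, ψ t = 0) → incEisCusp Γ σ ψ z = ψ v := by
  have hle : ConjAct.toConjAct (Matrix.SpecialLinearGroup.toGL σ : GL (Fin 2) ℝ)⁻¹ • Γ ≤
      (Matrix.SpecialLinearGroup.toGL : SL(2, ℝ) →* GL (Fin 2) ℝ).range := by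
    rw [← map_inv]; exact conj_le_range hΓ σ⁻¹
  obtain ⟨v, hv, h⟩ := exists_incEis_eq_apply hle ((neg_one_mem_conj_iff _).mpr hneg) (hd.conj _)
    (upperRightHom_one_mem_of_periods hper) hY (σ⁻¹ • z)
  exact ⟨v, hv, fun ψ hψ => h ψ hψ⟩

variable (hΓ : Γ ≤ (Matrix.SpecialLinearGroup.toGL : SL(2, ℝ) →* GL (Fin 2) ℝ).range)
  (hneg : (-1 : GL (Fin 2) ℝ) ∈ Γ) (hd : IsDiscreteSubgroup Γ) (σ : SL(2, ℝ))
  (hper : (ConjAct.toConjAct (Matrix.SpecialLinearGroup.toGL σ : GL (Fin 2) ℝ)⁻¹ • Γ).strictPeriods =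
    AddSubgroup.zmultiples 1)

include hΓ hneg hd hper in
/-- **Multiplicativity**: `E_𝔞(z|ψ) · E_𝔞(z|ψ') = E_𝔞(z|ψψ')` for profiles vanishing on `(-∞, Y]`,
`Y ≥ 1`. [cite: Iwaniec2002, §3.2 (3.16) & §6.4 (6.29), PDF pp. 44, 88] -/
theorem incEisCusp_mul {Y : ℝ} (hY : 1 ≤ Y) {ψ ψ' : ℝ → ℂ} (hψ : ∀ t ≤ Y, ψ t = 0)
    (hψ' : ∀ t ≤ Y, ψ' t = 0) (z : ℍ) :
    incEisCusp Γ σ ψ z * incEisCusp Γ σ ψ' z = incEisCusp Γ σ (fun t => ψ t * ψ' t) z := by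
  obtain ⟨v, -, h⟩ := exists_incEisCusp_eq_apply hΓ hneg hd σ hper hY z
  rw [h ψ hψ, h ψ' hψ', h (fun t => ψ t * ψ' t) (fun t ht => by simp [hψ t ht])]

include hΓ hneg hd hper in
/-- `|E_𝔞(z|ψ)|² = E_𝔞(z| |ψ|²)` for profiles vanishing on `(-∞, Y]`, `Y ≥ 1`. [cite: Iwaniec2002, §3.2 (3.16), PDF p. 44] -/
theorem norm_sq_incEisCusp {Y : ℝ} (hY : 1 ≤ Y) {ψ : ℝ → ℂ} (hψ : ∀ t ≤ Y, ψ t = 0) (z : ℍ) :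
    ((‖incEisCusp Γ σ ψ z‖ ^ 2 : ℝ) : ℂ) = incEisCusp Γ σ (fun t => ((‖ψ t‖ ^ 2 : ℝ) : ℂ)) z := by
  obtain ⟨v, -, h⟩ := exists_incEisCusp_eq_apply hΓ hneg hd σ hper hY z
  rw [h ψ hψ, h (fun t => ((‖ψ t‖ ^ 2 : ℝ) : ℂ)) (fun t ht => by simp [hψ t ht])]

include hΓ hneg hd hper in
/-- `conj E_𝔞(z|ψ) = E_𝔞(z|conj ψ)` for profiles vanishing on `(-∞, Y]`, `Y ≥ 1`. [cite: Iwaniec2002, §3.2 (3.12), PDF p. 43] -/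
theorem conj_incEisCusp {Y : ℝ} (hY : 1 ≤ Y) {ψ : ℝ → ℂ} (hψ : ∀ t ≤ Y, ψ t = 0) (z : ℍ) :
    (starRingEnd ℂ) (incEisCusp Γ σ ψ z) = incEisCusp Γ σ (fun t => (starRingEnd ℂ) (ψ t)) z := by
  obtain ⟨v, -, h⟩ := exists_incEisCusp_eq_apply hΓ hneg hd σ hper hY z
  rw [h ψ hψ, h (fun t => (starRingEnd ℂ) (ψ t)) (fun t ht => by simp [hψ t ht])]

include hΓ hneg hd hper in
/-- `‖E_𝔞(z|ψ)‖ ≤ sup |ψ|` for profiles vanishing on `(-∞, Y]`, `Y ≥ 1` (evaluation form). [cite: Iwaniec2002, §3.2 (3.16), PDF p. 44] -/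
theorem norm_incEisCusp_le_of_bound {Y : ℝ} (hY : 1 ≤ Y) {ψ : ℝ → ℂ} (hψ : ∀ t ≤ Y, ψ t = 0)
    {B : ℝ} (hB : ∀ t, ‖ψ t‖ ≤ B) (z : ℍ) : ‖incEisCusp Γ σ ψ z‖ ≤ B := by
  obtain ⟨v, -, h⟩ := exists_incEisCusp_eq_apply hΓ hneg hd σ hper hY z
  rw [h ψ hψ]; exact hB v

end Rows

/-! ## 2. The `L²(F)`-norm of `E_𝔞(·|ψ)`: unfolding of non-negative functions -/

section Norm

open _root_.MeasureTheory _root_.Set _root_.Filter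
open scoped _root_.Pointwise _root_.ENNReal _root_.Topology

/-- `ℝ≥0∞` version of `tsum_indicator_strip_eq`: summing over `Γ` against the strip is summing over
the rows. [cite: Iwaniec2002, §3.2 (proof of Lemma 3.3), PDF p. 44] -/
theorem tsum_indicator_strip_eq_ennreal
    (hΓ : Γ ≤ (Matrix.SpecialLinearGroup.toGL : SL(2, ℝ) →* GL (Fin 2) ℝ).range)
    (hd : IsDiscreteSubgroup Γ) (hP : Γ.strictPeriods = AddSubgroup.zmultiples 1)
    (G : (Fin 2 → ℝ) → ℝ≥0∞) (z : ℍ) :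
    ∑' γ : Γ, (cuspStrip 0).indicator (fun _ => (1 : ℝ≥0∞)) ((γ : GL (Fin 2) ℝ) • z) *
        G ((((γ : GL (Fin 2) ℝ)) : Matrix (Fin 2) (Fin 2) ℝ) 1) =
      ∑' r : rows Γ, G r.1 := by
  have e1 : (fun γ : Γ => (cuspStrip 0).indicator (fun _ => (1 : ℝ≥0∞)) ((γ : GL (Fin 2) ℝ) • z) *
      G ((((γ : GL (Fin 2) ℝ)) : Matrix (Fin 2) (Fin 2) ℝ) 1)) =
      {γ : Γ | ((γ : GL (Fin 2) ℝ)) • z ∈ cuspStrip 0}.indicator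
        (fun γ : Γ => G ((((γ : GL (Fin 2) ℝ)) : Matrix (Fin 2) (Fin 2) ℝ) 1)) := by
    funext γ
    by_cases h : ((γ : GL (Fin 2) ℝ)) • z ∈ cuspStrip 0
    · rw [Set.indicator_of_mem h, one_mul, Set.indicator_of_mem (by exact h)]
    · rw [Set.indicator_of_notMem h, zero_mul, Set.indicator_of_notMem (by exact h)]
  rw [e1, ← _root_.tsum_subtype]
  exact (stripEquiv hΓ hd hP z).tsum_eq (fun r : rows Γ => G r.1)

/-- **The row sum of `|ψ|²` is `2 |E(z|ψ)|²`** for profiles vanishing on `(-∞, Y]`, `Y ≥ 1` (only the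
pair `±r` of high rows contributes). [cite: Iwaniec2002, §3.2 (3.16), PDF p. 44] -/
theorem tsum_enorm_sq_rows_eq
    (hΓ : Γ ≤ (Matrix.SpecialLinearGroup.toGL : SL(2, ℝ) →* GL (Fin 2) ℝ).range)
    (hneg : (-1 : GL (Fin 2) ℝ) ∈ Γ) (hd : IsDiscreteSubgroup Γ)
    (hT : Matrix.GeneralLinearGroup.upperRightHom (1 : ℝ) ∈ Γ) {Y : ℝ} (hY : 1 ≤ Y)
    {ψ : ℝ → ℂ} (hψ : ∀ t ≤ Y, ψ t = 0) (z : ℍ) :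
    ∑' r : rows Γ, ‖ψ (rowIm r.1 z)‖ₑ ^ 2 = 2 * ‖incEis Γ ψ z‖ₑ ^ 2 := by
  classical
  by_cases h : ∃ r ∈ rows Γ, Y < rowIm r z
  · obtain ⟨r₀, hr₀, hr₀Y⟩ := h
    have hr₀ne : r₀ ≠ -r₀ := by
      intro he
      have h0 : r₀ = 0 := by
        have : (2 : ℝ) • r₀ = 0 := by rw [two_smul]; nth_rewrite 2 [he]; exact add_neg_cancel r₀
        exact (smul_eq_zero.mp this).resolve_left two_ne_zero
      exact ne_zero_of_mem_rows hr₀ h0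
    set a : rows Γ := ⟨r₀, hr₀⟩ with ha
    set b : rows Γ := ⟨-r₀, neg_mem_rows hneg hr₀⟩ with hb
    have hab : a ≠ b := fun he => hr₀ne (congrArg Subtype.val he)
    have hzero : ∀ r : rows Γ, r ∉ ({a, b} : Finset (rows Γ)) → ψ (rowIm r.1 z) = 0 := by
      intro r hr
      apply hψ
      by_contra hlt
      rw [not_le] at hlt
      rcases row_eq_or_eq_neg_of_lt_rowIm hΓ hd hT hY hr₀ r.2 hr₀Y hlt with h1 | h1
      · exact hr (by rw [Finset.mem_insert]; left; exact Subtype.ext h1)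
      · exact hr (by rw [Finset.mem_insert, Finset.mem_singleton]; right; exact Subtype.ext h1)
    have hsupp : ∀ r : rows Γ, r ∉ ({a, b} : Finset (rows Γ)) → ‖ψ (rowIm r.1 z)‖ₑ ^ 2 = 0 := by
      intro r hr; rw [hzero r hr]; simp
    -- the value of `E(z|ψ)`
    have hval : incEis Γ ψ z = ψ (rowIm r₀ z) := by
      unfold incEis
      rw [tsum_eq_sum hzero, Finset.sum_pair hab]
      simp only [ha, hb, rowIm_neg]
      ring
    rw [tsum_eq_sum hsupp, Finset.sum_pair hab, hval]
    simp only [ha, hb, rowIm_neg]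
    rw [two_mul]
  · push Not at h
    have h0 : incEis Γ ψ z = 0 := incEis_eq_zero_of_forall_rowIm_le (a := Y) hψ h
    have hterm : ∀ r : rows Γ, ‖ψ (rowIm r.1 z)‖ₑ ^ 2 = 0 := by
      intro r; rw [hψ _ (h r.1 r.2)]; simp
    rw [h0]
    simp [hterm]

/-- **Pointwise unfolding identity for `|E_𝔞(·|ψ)|²`**: for `Y ≥ 1` and `ψ` vanishing on `(-∞, Y]`,
`Σ_{γ ∈ Γ} 𝟙_P(σ⁻¹γz) |ψ(Im σ⁻¹γz)|² = 2 |E_𝔞(z|ψ)|²` in `ℝ≥0∞`. [cite: Iwaniec2002, Lemma 3.3 (proof) & (3.16), PDF p. 44] -/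
theorem tsum_strip_enorm_sq_eq_cusp
    (hΓ : Γ ≤ (Matrix.SpecialLinearGroup.toGL : SL(2, ℝ) →* GL (Fin 2) ℝ).range)
    (hneg : (-1 : GL (Fin 2) ℝ) ∈ Γ) (hd : IsDiscreteSubgroup Γ) (σ : SL(2, ℝ))
    (hper : (ConjAct.toConjAct (Matrix.SpecialLinearGroup.toGL σ : GL (Fin 2) ℝ)⁻¹ • Γ).strictPeriods =
      AddSubgroup.zmultiples 1)
    {Y : ℝ} (hY : 1 ≤ Y) {ψ : ℝ → ℂ} (hψ : ∀ t ≤ Y, ψ t = 0) (z : ℍ) :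
    ∑' γ : Γ, (cuspStrip 0).indicator (fun _ => (1 : ℝ≥0∞)) (σ⁻¹ • (γ : GL (Fin 2) ℝ) • z) *
        ‖ψ (σ⁻¹ • (γ : GL (Fin 2) ℝ) • z).im‖ₑ ^ 2 =
      2 * ‖incEisCusp Γ σ ψ z‖ₑ ^ 2 := by
  set S : GL (Fin 2) ℝ := Matrix.SpecialLinearGroup.toGL σ with hS
  set Γ' : Subgroup (GL (Fin 2) ℝ) := ConjAct.toConjAct S⁻¹ • Γ with hΓ'
  have hΓ'le : Γ' ≤ (Matrix.SpecialLinearGroup.toGL : SL(2, ℝ) →* GL (Fin 2) ℝ).range := by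
    rw [hΓ', hS, ← map_inv]; exact conj_le_range hΓ σ⁻¹
  have hd' : IsDiscreteSubgroup Γ' := hd.conj _
  have hneg' : (-1 : GL (Fin 2) ℝ) ∈ Γ' := (neg_one_mem_conj_iff _).mpr hneg
  have hT' : Matrix.GeneralLinearGroup.upperRightHom (1 : ℝ) ∈ Γ' := upperRightHom_one_mem_of_periods hper
  have e1 : ∀ w : ℍ, σ⁻¹ • w = S⁻¹ • w := fun w => by rw [hS, ← map_inv]; rfl
  have h1 := tsum_indicator_strip_eq_ennreal hΓ'le hd' hper (fun r => ‖ψ (rowIm r (σ⁻¹ • z))‖ₑ ^ 2) (σ⁻¹ • z)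
  have h2 := tsum_enorm_sq_rows_eq hΓ'le hneg' hd' hT' hY hψ (σ⁻¹ • z)
  rw [show incEisCusp Γ σ ψ z = incEis Γ' ψ (σ⁻¹ • z) from rfl, ← h2, ← h1, ← (conjEquiv S).tsum_eq]
  refine tsum_congr fun γ => ?_
  have e : ((conjEquiv S γ : Γ') : GL (Fin 2) ℝ) • (σ⁻¹ • z) = σ⁻¹ • (γ : GL (Fin 2) ℝ) • z := by
    rw [coe_conjEquiv, e1, e1, mul_smul, mul_smul, smul_inv_smul]
  rw [e, ← im_smul_eq_rowIm (hΓ'le (conjEquiv S γ).2) (σ⁻¹ • z), e]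

/-- **Tonelli on the semi-strip for functions of the height**:
`∫⁻_{P(0)} Φ(Im w) dμ(w) = ∫⁻_0^∞ Φ(y) y⁻² dy`. [cite: Iwaniec2002, Lemma 3.3 (3.14), PDF p. 44] -/
theorem lintegral_cuspStrip_comp_im (Φ : ℝ → ℝ≥0∞) (hΦ : Measurable Φ) :
    ∫⁻ w in cuspStrip 0, Φ w.im = ∫⁻ y in Ioi (0 : ℝ), Φ y * ENNReal.ofReal ((y ^ 2)⁻¹) := by
  have hmeas : Measurable fun z : ℂ => ENNReal.ofReal ((z.im ^ 2)⁻¹) *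
      ((cuspStrip 0).indicator (fun w : ℍ => Φ w.im)) (invCoe z) :=
    (ENNReal.measurable_ofReal.comp ((Complex.measurable_im.pow_const 2).inv)).mul
      (((hΦ.comp UpperHalfPlane.continuous_im.measurable).indicator (measurableSet_cuspStrip 0)).comp
        measurable_invCoe)
  have hind : Measurable ((cuspStrip 0).indicator (fun w : ℍ => Φ w.im)) :=
    (hΦ.comp UpperHalfPlane.continuous_im.measurable).indicator (measurableSet_cuspStrip 0)
  rw [← lintegral_indicator (measurableSet_cuspStrip 0),
    lintegral_upperHalfPlane_eq ((cuspStrip 0).indicator (fun w : ℍ => Φ w.im)) hind,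
    setLIntegral_upperHalf_eq_iterated _ hmeas]
  refine setLIntegral_congr_fun measurableSet_Ioi fun y hy => ?_
  have hy' : (0 : ℝ) < y := hy
  have hmx : Measurable fun x : ℝ => (Ico (0 : ℝ) 1).indicator (fun _ : ℝ => Φ y) x :=
    measurable_const.indicator measurableSet_Ico
  have e : ∀ x : ℝ, ENNReal.ofReal (((⟨x, y⟩ : ℂ).im ^ 2)⁻¹) *
      (cuspStrip 0).indicator (fun w : ℍ => Φ w.im) (invCoe ⟨x, y⟩) =
      (Ico (0 : ℝ) 1).indicator (fun _ : ℝ => Φ y) x * ENNReal.ofReal ((y ^ 2)⁻¹) := by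
    intro x
    rw [invCoe_mk hy']
    simp only [Set.indicator]
    have hiff : pt x y ∈ cuspStrip 0 ↔ x ∈ Ico (0 : ℝ) 1 := by
      simp only [mem_cuspStrip_iff, pt_re hy', pt_im hy', mem_Ico]
      exact ⟨fun h => ⟨h.1, h.2.1⟩, fun h => ⟨h.1, h.2, hy'⟩⟩
    by_cases hx : x ∈ Ico (0 : ℝ) 1
    · rw [if_pos (hiff.mpr hx), if_pos hx, pt_im hy', mul_comm]
    · rw [if_neg (fun h => hx (hiff.mp h)), if_neg hx, mul_zero, zero_mul]
  simp_rw [e]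
  rw [lintegral_mul_const _ hmx, lintegral_indicator measurableSet_Ico, setLIntegral_const, Real.volume_Ico]
  simp

variable {F : Set ℍ}
variable (hΓ : Γ ≤ (Matrix.SpecialLinearGroup.toGL : SL(2, ℝ) →* GL (Fin 2) ℝ).range)
  (hneg : (-1 : GL (Fin 2) ℝ) ∈ Γ) (hd : IsDiscreteSubgroup Γ) (hF : IsHypFundamentalDomain Γ F)
  (σ : SL(2, ℝ))
  (hper : (ConjAct.toConjAct (Matrix.SpecialLinearGroup.toGL σ : GL (Fin 2) ℝ)⁻¹ • Γ).strictPeriods =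
    AddSubgroup.zmultiples 1)

include hΓ hneg hd hF hper in
/-- **The `L²(F)`-norm of an incomplete Eisenstein series of a high profile** (Lemma 3.3 with
`f = conj E_𝔞(·|ψ)`, as a Lebesgue integral, no integrability hypothesis): for `Y ≥ 1` and `ψ`
measurable vanishing on `(-∞, Y]`, `∫_F |E_𝔞(z|ψ)|² dμ(z) = ∫_0^∞ |ψ(y)|² y⁻² dy`.
[cite: Iwaniec2002, Lemma 3.3 (3.14) & (3.16), PDF p. 44] -/
theorem lintegral_enorm_sq_incEisCusp {Y : ℝ} (hY : 1 ≤ Y) {ψ : ℝ → ℂ} (hψm : Measurable ψ)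
    (hψ : ∀ t ≤ Y, ψ t = 0) :
    ∫⁻ z in F, ‖incEisCusp Γ σ ψ z‖ₑ ^ 2 = ∫⁻ y in Ioi (0 : ℝ), ‖ψ y‖ₑ ^ 2 * ENNReal.ofReal ((y ^ 2)⁻¹) := by
  set S : GL (Fin 2) ℝ := Matrix.SpecialLinearGroup.toGL σ with hS
  set Φ₀ : ℍ → ℝ≥0∞ := fun w => (cuspStrip 0).indicator (fun _ => (1 : ℝ≥0∞)) w * ‖ψ w.im‖ₑ ^ 2 with hΦ₀
  set Φ : ℍ → ℝ≥0∞ := fun w => Φ₀ (σ⁻¹ • w) with hΦ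
  have hΦ₀m : Measurable Φ₀ :=
    (measurable_const.indicator (measurableSet_cuspStrip 0)).mul
      ((hψm.comp UpperHalfPlane.continuous_im.measurable).enorm.pow_const 2)
  have hΦm : Measurable Φ := hΦ₀m.comp (continuous_const_smul σ⁻¹).measurable
  have hunf := setLIntegral_tsum_smul_eq hΓ hneg hd.countable hF hΦm.aemeasurable
  have hpt : ∀ z : ℍ, ∑' γ : Γ, Φ ((γ : GL (Fin 2) ℝ) • z) = 2 * ‖incEisCusp Γ σ ψ z‖ₑ ^ 2 := by
    intro z
    rw [← tsum_strip_enorm_sq_eq_cusp hΓ hneg hd σ hper hY hψ z]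
  simp_rw [hpt] at hunf
  rw [lintegral_const_mul _ ((measurable_incEisCusp hΓ hd σ hper hψm (a := Y)
    (fun t ht => hψ t ht.le) (by linarith)).enorm.pow_const 2)] at hunf
  have hunf' : ∫⁻ z in F, ‖incEisCusp Γ σ ψ z‖ₑ ^ 2 = ∫⁻ w, Φ w :=
    (ENNReal.mul_right_inj two_ne_zero ENNReal.ofNat_ne_top).mp hunf
  rw [hunf', hΦ]
  -- invariance of the measure under `σ⁻¹`
  have hmp := (measurePreserving_smul ((S⁻¹ : GL (Fin 2) ℝ)) (volume : Measure ℍ)).lintegral_comp_emb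
    (MeasurableEquiv.smul ((S⁻¹ : GL (Fin 2) ℝ))).measurableEmbedding Φ₀
  have e1 : (fun w : ℍ => Φ₀ (σ⁻¹ • w)) = fun w : ℍ => Φ₀ ((S⁻¹ : GL (Fin 2) ℝ) • w) := by
    funext w; rw [hS, ← map_inv]; rfl
  rw [e1, hmp]
  have e2 : Φ₀ = (cuspStrip 0).indicator (fun w : ℍ => ‖ψ w.im‖ₑ ^ 2) := by
    funext w
    change (cuspStrip 0).indicator (fun _ => (1 : ℝ≥0∞)) w * ‖ψ w.im‖ₑ ^ 2 = _
    by_cases hw : w ∈ cuspStrip 0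
    · rw [Set.indicator_of_mem hw, Set.indicator_of_mem hw, one_mul]
    · rw [Set.indicator_of_notMem hw, Set.indicator_of_notMem hw, zero_mul]
  rw [e2, lintegral_indicator (measurableSet_cuspStrip 0)]
  exact lintegral_cuspStrip_comp_im (fun y => ‖ψ y‖ₑ ^ 2) (hψm.enorm.pow_const 2)

end Norm

/-! ## 3. Log-height profiles and the isometry `L²((log Y, ∞)) → L²(F)` -/

section Isometry

open _root_.MeasureTheory _root_.Set _root_.Filter
open scoped _root_.Pointwise _root_.ENNReal _root_.Topology

/-- `‖f‖_{L²(μ)}` through the Lebesgue integral of `|f|²`. [folklore] -/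
theorem eLpNorm_two_eq_lintegral_rpow {α : Type*} [MeasurableSpace α] {μ : Measure α} (f : α → ℂ) :
    eLpNorm f 2 μ = (∫⁻ x, ‖f x‖ₑ ^ 2 ∂μ) ^ (1 / 2 : ℝ) := by
  rw [eLpNorm_eq_lintegral_rpow_enorm_toReal (by norm_num) ENNReal.ofNat_ne_top]
  simp only [ENNReal.toReal_ofNat, one_div]
  congr 1
  refine lintegral_congr fun w => ?_
  rw [← ENNReal.rpow_natCast]; norm_num

/-- `MemLp f 2` from the finiteness of `∫ |f|²`. [folklore] -/
theorem memLp_two_of_lintegral_enorm_sq_ne_top {α : Type*} [MeasurableSpace α] {μ : Measure α}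
    {f : α → ℂ} (hfm : AEStronglyMeasurable f μ) (h : ∫⁻ x, ‖f x‖ₑ ^ 2 ∂μ ≠ ⊤) : MemLp f 2 μ := by
  refine ⟨hfm, ?_⟩
  rw [eLpNorm_two_eq_lintegral_rpow]
  exact ENNReal.rpow_lt_top_of_nonneg (by norm_num) h

/-- The `L²` norm of a class through the Lebesgue integral of its representative. [folklore] -/
theorem Lp_norm_eq_toReal_rpow {α : Type*} [MeasurableSpace α] {μ : Measure α} (g : Lp ℂ 2 μ) :
    ‖g‖ = ((∫⁻ x, ‖g x‖ₑ ^ 2 ∂μ) ^ (1 / 2 : ℝ)).toReal := by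
  rw [Lp.norm_def, eLpNorm_two_eq_lintegral_rpow]

/-- **The log-height profile** attached to `Ψ : ℝ → ℂ` above the height `Y`:
`φ(y) = 𝟙_{y > Y} √y Ψ(log y)` (so that `∫ |φ(y)|² y⁻² dy = ∫_{log Y}^∞ |Ψ(v)|² dv` and the action of
invariant integral operators on `φ(Im z)` becomes a convolution in `v = log y`, (4.12)).
[cite: Iwaniec2002, §4.2 (4.12), PDF p. 51] -/
def liftProfile (Y : ℝ) (Ψ : ℝ → ℂ) (y : ℝ) : ℂ :=
  if Y < y then ((Real.sqrt y : ℝ) : ℂ) * Ψ (Real.log y) else 0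

/-- The lifted profile vanishes on `(-∞, Y]`. [folklore] -/
theorem liftProfile_eq_zero_of_le {Y : ℝ} (Ψ : ℝ → ℂ) {y : ℝ} (hy : y ≤ Y) : liftProfile Y Ψ y = 0 := by
  simp [liftProfile, not_lt.mpr hy]

/-- The lifted profile above `Y`. [folklore] -/
theorem liftProfile_eq_of_lt {Y : ℝ} (Ψ : ℝ → ℂ) {y : ℝ} (hy : Y < y) :
    liftProfile Y Ψ y = ((Real.sqrt y : ℝ) : ℂ) * Ψ (Real.log y) := by
  simp [liftProfile, hy]

/-- Measurability of the lifted profile. [folklore] -/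
theorem measurable_liftProfile (Y : ℝ) {Ψ : ℝ → ℂ} (hΨ : Measurable Ψ) : Measurable (liftProfile Y Ψ) := by
  unfold liftProfile
  refine Measurable.ite measurableSet_Ioi ?_ measurable_const
  exact (Complex.measurable_ofReal.comp Real.continuous_sqrt.measurable).mul (hΨ.comp Real.measurable_log)

/-- The lift is additive. [folklore] -/
theorem liftProfile_add (Y : ℝ) (Ψ Ψ' : ℝ → ℂ) :
    liftProfile Y (Ψ + Ψ') = liftProfile Y Ψ + liftProfile Y Ψ' := by
  funext y
  by_cases hy : Y < y
  · simp [liftProfile, hy, mul_add]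
  · simp [liftProfile, hy]

/-- The lift is homogeneous. [folklore] -/
theorem liftProfile_smul (Y : ℝ) (c : ℂ) (Ψ : ℝ → ℂ) :
    liftProfile Y (c • Ψ) = c • liftProfile Y Ψ := by
  funext y
  by_cases hy : Y < y
  · simp [liftProfile, hy]; ring
  · simp [liftProfile, hy]

/-- The lift only sees `Ψ` on `(log Y, ∞)`: profiles agreeing there have the same lift (`Y > 0`). [folklore] -/
theorem liftProfile_congr {Y : ℝ} (hY : 0 < Y) {Ψ Ψ' : ℝ → ℂ} (h : ∀ v, Real.log Y < v → Ψ v = Ψ' v) :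
    liftProfile Y Ψ = liftProfile Y Ψ' := by
  funext y
  by_cases hy : Y < y
  · rw [liftProfile_eq_of_lt Ψ hy, liftProfile_eq_of_lt Ψ' hy, h _ (Real.log_lt_log hY hy)]
  · rw [liftProfile_eq_zero_of_le Ψ (not_lt.mp hy), liftProfile_eq_zero_of_le Ψ' (not_lt.mp hy)]

/-- **The weighted norm of the lifted profile**: `∫_0^∞ |φ(y)|² y⁻² dy = ∫_{log Y}^∞ |Ψ(v)|² dv`
(`y = e^v`). [cite: Iwaniec2002, §4.2 (4.12), PDF p. 51] -/
theorem lintegral_enorm_sq_liftProfile {Y : ℝ} (hY : 0 < Y) (Ψ : ℝ → ℂ) :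
    ∫⁻ y in Ioi (0 : ℝ), ‖liftProfile Y Ψ y‖ₑ ^ 2 * ENNReal.ofReal ((y ^ 2)⁻¹) =
      ∫⁻ v in Ioi (Real.log Y), ‖Ψ v‖ₑ ^ 2 := by
  -- restrict to `(Y, ∞)`
  have h1 : ∫⁻ y in Ioi (0 : ℝ), ‖liftProfile Y Ψ y‖ₑ ^ 2 * ENNReal.ofReal ((y ^ 2)⁻¹) =
      ∫⁻ y in Ioi Y, ‖Ψ (Real.log y)‖ₑ ^ 2 * ENNReal.ofReal (y⁻¹) := by
    rw [← lintegral_indicator measurableSet_Ioi, ← lintegral_indicator measurableSet_Ioi]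
    refine lintegral_congr fun y => ?_
    by_cases hy : Y < y
    · have hy0 : 0 < y := hY.trans hy
      have hsq : ‖((Real.sqrt y : ℝ) : ℂ)‖ₑ ^ 2 = ENNReal.ofReal y := by
        rw [enorm_eq_nnnorm, Complex.nnnorm_real, ← enorm_eq_nnnorm, Real.enorm_eq_ofReal (Real.sqrt_nonneg y),
          ← ENNReal.ofReal_pow (Real.sqrt_nonneg y), Real.sq_sqrt hy0.le]
      rw [indicator_of_mem (show y ∈ Ioi (0 : ℝ) from hy0), indicator_of_mem (show y ∈ Ioi Y from hy),
        liftProfile_eq_of_lt Ψ hy, enorm_mul, mul_pow, hsq, mul_comm (ENNReal.ofReal y), mul_assoc,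
        ← ENNReal.ofReal_mul hy0.le]
      congr 2
      field_simp
    · rw [indicator_of_notMem (show y ∉ Ioi Y from hy)]
      by_cases hy0 : 0 < y
      · rw [indicator_of_mem (show y ∈ Ioi (0 : ℝ) from hy0), liftProfile_eq_zero_of_le Ψ (not_lt.mp hy)]
        simp
      · rw [indicator_of_notMem (show y ∉ Ioi (0 : ℝ) from hy0)]
  rw [h1]
  -- substitute `y = e^v`
  have himg : Real.exp '' Ioi (Real.log Y) = Ioi Y := by
    rw [Real.image_exp_Ioi, Real.exp_log hY]
  have hderiv : ∀ v ∈ Ioi (Real.log Y), HasDerivWithinAt Real.exp (Real.exp v) (Ioi (Real.log Y)) v :=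
    fun v _ => (Real.hasDerivAt_exp v).hasDerivWithinAt
  rw [← himg, lintegral_image_eq_lintegral_abs_deriv_mul measurableSet_Ioi hderiv
    Real.exp_injective.injOn]
  refine setLIntegral_congr_fun measurableSet_Ioi fun v _ => ?_
  rw [Real.log_exp, abs_of_pos (Real.exp_pos v), mul_comm (‖Ψ v‖ₑ ^ 2), ← mul_assoc,
    ← ENNReal.ofReal_mul (Real.exp_pos v).le, ← Real.exp_neg, ← Real.exp_add, add_neg_cancel,
    Real.exp_zero, ENNReal.ofReal_one, one_mul]

variable {F : Set ℍ}
variable (hΓ : Γ ≤ (Matrix.SpecialLinearGroup.toGL : SL(2, ℝ) →* GL (Fin 2) ℝ).range)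
  (hneg : (-1 : GL (Fin 2) ℝ) ∈ Γ) (hd : IsDiscreteSubgroup Γ) (hF : IsHypFundamentalDomain Γ F)
  (σ : SL(2, ℝ))
  (hper : (ConjAct.toConjAct (Matrix.SpecialLinearGroup.toGL σ : GL (Fin 2) ℝ)⁻¹ • Γ).strictPeriods =
    AddSubgroup.zmultiples 1)

variable (Γ) in
/-- **The cusp lift** of a log-height profile: `(V_𝔞 Ψ)(z) = E_𝔞(z | 𝟙_{y>Y} √y Ψ(log y))`, the
automorphic function which in the cuspidal zone `σ_𝔞 P(Y)` equals `√y Ψ(log y)` (`y = Im σ_𝔞⁻¹z`)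
and vanishes outside it modulo `Γ` (`Y ≥ 1`). [cite: Iwaniec2002, §3.2 (3.12) & (3.16), §6.4 (6.29), PDF pp. 43–44, 88] -/
def cuspLift (σ : SL(2, ℝ)) (Y : ℝ) (Ψ : ℝ → ℂ) : ℍ → ℂ := incEisCusp Γ σ (liftProfile Y Ψ)

include hΓ hneg hd hper in
/-- **Evaluation form of the cusp lift**: at each `z` one height `v` serves all profiles. [cite: Iwaniec2002, §3.2 (3.16), PDF p. 44] -/
theorem exists_cuspLift_eq_apply {Y : ℝ} (hY : 1 ≤ Y) (z : ℍ) :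
    ∃ v : ℝ, ∀ Ψ : ℝ → ℂ, cuspLift Γ σ Y Ψ z = liftProfile Y Ψ v := by
  obtain ⟨v, -, h⟩ := exists_incEisCusp_eq_apply hΓ hneg hd σ hper hY z
  exact ⟨v, fun Ψ => h _ fun _ ht => liftProfile_eq_zero_of_le Ψ ht⟩

include hΓ hneg hd hper in
/-- The cusp lift is additive (`Y ≥ 1`). [folklore] -/
theorem cuspLift_add {Y : ℝ} (hY : 1 ≤ Y) (Ψ Ψ' : ℝ → ℂ) :
    cuspLift Γ σ Y (Ψ + Ψ') = cuspLift Γ σ Y Ψ + cuspLift Γ σ Y Ψ' := by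
  funext z
  obtain ⟨v, h⟩ := exists_cuspLift_eq_apply hΓ hneg hd σ hper hY z
  rw [Pi.add_apply, h, h, h, liftProfile_add, Pi.add_apply]

include hΓ hneg hd hper in
/-- The cusp lift is homogeneous (`Y ≥ 1`). [folklore] -/
theorem cuspLift_smul {Y : ℝ} (hY : 1 ≤ Y) (c : ℂ) (Ψ : ℝ → ℂ) :
    cuspLift Γ σ Y (c • Ψ) = c • cuspLift Γ σ Y Ψ := by
  funext z
  obtain ⟨v, h⟩ := exists_cuspLift_eq_apply hΓ hneg hd σ hper hY z
  rw [Pi.smul_apply, h, h, liftProfile_smul, Pi.smul_apply]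

include hΓ hneg hd hper in
/-- The cusp lift is subtractive (`Y ≥ 1`). [folklore] -/
theorem cuspLift_sub {Y : ℝ} (hY : 1 ≤ Y) (Ψ Ψ' : ℝ → ℂ) :
    cuspLift Γ σ Y (Ψ - Ψ') = cuspLift Γ σ Y Ψ - cuspLift Γ σ Y Ψ' := by
  rw [sub_eq_add_neg, cuspLift_add hΓ hneg hd σ hper hY, show -Ψ' = (-1 : ℂ) • Ψ' by simp,
    cuspLift_smul hΓ hneg hd σ hper hY]
  simp [sub_eq_add_neg]

/-- The cusp lift only sees the profile on `(log Y, ∞)`. [folklore] -/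
theorem cuspLift_congr {Y : ℝ} (hY : 1 ≤ Y) {Ψ Ψ' : ℝ → ℂ} (h : ∀ v, Real.log Y < v → Ψ v = Ψ' v) :
    cuspLift Γ σ Y Ψ = cuspLift Γ σ Y Ψ' := by
  unfold cuspLift; rw [liftProfile_congr (by linarith) h]

include hΓ hd hper in
/-- The cusp lift of a measurable profile is measurable (`Y > 0`). [folklore] -/
theorem measurable_cuspLift {Y : ℝ} (hY : 0 < Y) {Ψ : ℝ → ℂ} (hΨ : Measurable Ψ) :
    Measurable (cuspLift Γ σ Y Ψ) :=
  measurable_incEisCusp hΓ hd σ hper (measurable_liftProfile Y hΨ) (a := Y)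
    (fun _ ht => liftProfile_eq_zero_of_le Ψ ht.le) hY

include hΓ in
/-- The cusp lift is automorphic. [cite: Iwaniec2002, §3.2 (3.12), PDF p. 43] -/
theorem isAutomorphic_cuspLift (Y : ℝ) (Ψ : ℝ → ℂ) : IsAutomorphic Γ (cuspLift Γ σ Y Ψ) :=
  isAutomorphic_incEisCusp hΓ σ _

include hΓ hneg hd hF hper in
/-- **The cusp lift is an isometry `L²((log Y, ∞)) → L²(F)`** at the level of Lebesgue integrals:
`∫_F |V_𝔞Ψ|² dμ = ∫_{log Y}^∞ |Ψ(v)|² dv` (`Y ≥ 1`, `Ψ` measurable). [cite: Iwaniec2002, Lemma 3.3 (3.14) & (3.16), §4.2 (4.12), PDF pp. 44, 51] -/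
theorem lintegral_enorm_sq_cuspLift {Y : ℝ} (hY : 1 ≤ Y) {Ψ : ℝ → ℂ} (hΨ : Measurable Ψ) :
    ∫⁻ z in F, ‖cuspLift Γ σ Y Ψ z‖ₑ ^ 2 = ∫⁻ v in Ioi (Real.log Y), ‖Ψ v‖ₑ ^ 2 := by
  unfold cuspLift
  rw [lintegral_enorm_sq_incEisCusp hΓ hneg hd hF σ hper hY (measurable_liftProfile Y hΨ)
    (fun _ ht => liftProfile_eq_zero_of_le Ψ ht), lintegral_enorm_sq_liftProfile (by linarith) Ψ]

include hΓ hneg hd hF hper in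
/-- The cusp lift of a square-integrable profile is in `L²(F)`. [folklore] -/
theorem memLp_cuspLift {Y : ℝ} (hY : 1 ≤ Y) {Ψ : ℝ → ℂ} (hΨ : Measurable Ψ)
    (hΨ2 : ∫⁻ v in Ioi (Real.log Y), ‖Ψ v‖ₑ ^ 2 ≠ ⊤) : MemLp (cuspLift Γ σ Y Ψ) 2 (volume.restrict F) :=
  memLp_two_of_lintegral_enorm_sq_ne_top
    (measurable_cuspLift hΓ hd σ hper (by linarith) hΨ).aestronglyMeasurable
    (by rw [lintegral_enorm_sq_cuspLift hΓ hneg hd hF σ hper hY hΨ]; exact hΨ2)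

include hΓ hneg hd hF hper in
/-- Profiles agreeing a.e. on `(log Y, ∞)` have cusp lifts agreeing a.e. on `F` (through the
isometry). [folklore] -/
theorem cuspLift_ae_eq_of_ae_eq {Y : ℝ} (hY : 1 ≤ Y) {Ψ Ψ' : ℝ → ℂ} (hΨ : Measurable Ψ) (hΨ' : Measurable Ψ')
    (h : Ψ =ᵐ[volume.restrict (Ioi (Real.log Y))] Ψ') :
    cuspLift Γ σ Y Ψ =ᵐ[volume.restrict F] cuspLift Γ σ Y Ψ' := by
  have h0 : ∫⁻ v in Ioi (Real.log Y), ‖(Ψ - Ψ') v‖ₑ ^ 2 = 0 := by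
    rw [lintegral_eq_zero_iff ((hΨ.sub hΨ').enorm.pow_const 2)]
    filter_upwards [h] with v hv
    simp [hv]
  have h1 : ∫⁻ z in F, ‖cuspLift Γ σ Y (Ψ - Ψ') z‖ₑ ^ 2 = 0 := by
    rw [lintegral_enorm_sq_cuspLift hΓ hneg hd hF σ hper hY (hΨ.sub hΨ'), h0]
  rw [lintegral_eq_zero_iff ((measurable_cuspLift hΓ hd σ hper (by linarith) (hΨ.sub hΨ')).enorm.pow_const 2)] at h1
  filter_upwards [h1] with z hz
  have hz' : cuspLift Γ σ Y (Ψ - Ψ') z = 0 := by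
    simpa [sq_eq_zero_iff, enorm_eq_zero] using hz
  rw [cuspLift_sub hΓ hneg hd σ hper hY, Pi.sub_apply, sub_eq_zero] at hz'
  exact hz'

/-- `∫ |f|² < ∞` for `f ∈ L²`. [folklore] -/
theorem lintegral_enorm_sq_ne_top_of_Lp {α : Type*} [MeasurableSpace α] {μ : Measure α} (f : Lp ℂ 2 μ) :
    ∫⁻ x, ‖f x‖ₑ ^ 2 ∂μ ≠ ⊤ := by
  have h := (Lp.memLp f).2
  rw [eLpNorm_two_eq_lintegral_rpow] at h
  exact (ENNReal.rpow_lt_top_iff_of_pos (by norm_num : (0 : ℝ) < 1 / 2)).mp h |>.ne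

include hΓ hneg hd hF hper in
/-- **The cusp isometry `V_𝔞 : L²((log Y, ∞)) → L²(F)`** (`Y ≥ 1`): the class of the cusp lift.
[cite: Iwaniec2002, Lemma 3.3 & (3.16), §4.2 (4.12), PDF pp. 44, 51] -/
def cuspIsometry {Y : ℝ} (hY : 1 ≤ Y) :
    Lp ℂ 2 ((volume : Measure ℝ).restrict (Ioi (Real.log Y))) →ₗᵢ[ℂ] Lp ℂ 2 ((volume : Measure ℍ).restrict F) where
  toFun f := (memLp_cuspLift hΓ hneg hd hF σ hper hY (Lp.stronglyMeasurable f).measurable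
    (lintegral_enorm_sq_ne_top_of_Lp f)).toLp _
  map_add' f g := by
    have hfg : cuspLift Γ σ Y (⇑(f + g)) =ᵐ[volume.restrict F] cuspLift Γ σ Y ⇑f + cuspLift Γ σ Y ⇑g := by
      rw [← cuspLift_add hΓ hneg hd σ hper hY]
      exact cuspLift_ae_eq_of_ae_eq hΓ hneg hd hF σ hper hY (Lp.stronglyMeasurable (f + g)).measurable
        ((Lp.stronglyMeasurable f).measurable.add (Lp.stronglyMeasurable g).measurable) (Lp.coeFn_add f g)
    rw [← MemLp.toLp_add]
    exact MemLp.toLp_congr _ _ hfg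
  map_smul' c f := by
    have hcf : cuspLift Γ σ Y (⇑(c • f)) =ᵐ[volume.restrict F] c • cuspLift Γ σ Y ⇑f := by
      rw [← cuspLift_smul hΓ hneg hd σ hper hY]
      exact cuspLift_ae_eq_of_ae_eq hΓ hneg hd hF σ hper hY (Lp.stronglyMeasurable (c • f)).measurable
        ((Lp.stronglyMeasurable f).measurable.const_smul c) (Lp.coeFn_smul c f)
    rw [RingHom.id_apply, ← MemLp.toLp_const_smul]
    exact MemLp.toLp_congr _ _ hcf
  norm_map' f := by
    change ‖MemLp.toLp (cuspLift Γ σ Y ⇑f) (memLp_cuspLift hΓ hneg hd hF σ hper hY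
      (Lp.stronglyMeasurable f).measurable (lintegral_enorm_sq_ne_top_of_Lp f))‖ = ‖f‖
    rw [Lp.norm_toLp, Lp.norm_def, eLpNorm_two_eq_lintegral_rpow, eLpNorm_two_eq_lintegral_rpow,
      lintegral_enorm_sq_cuspLift hΓ hneg hd hF σ hper hY (Lp.stronglyMeasurable f).measurable]

include hΓ hneg hd hF hper in
/-- The representative of `V_𝔞 f` is the cusp lift of the representative of `f`, a.e. on `F`. [folklore] -/
theorem cuspIsometry_coeFn {Y : ℝ} (hY : 1 ≤ Y) (f : Lp ℂ 2 ((volume : Measure ℝ).restrict (Ioi (Real.log Y)))) :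
    (cuspIsometry hΓ hneg hd hF σ hper hY f : ℍ → ℂ) =ᵐ[volume.restrict F] cuspLift Γ σ Y ⇑f :=
  MemLp.coeFn_toLp (memLp_cuspLift hΓ hneg hd hF σ hper hY (Lp.stronglyMeasurable f).measurable
    (lintegral_enorm_sq_ne_top_of_Lp f))

include hΓ hneg hd hF hper in
/-- `V_𝔞` on the class of a measurable square-integrable profile. [folklore] -/
theorem cuspIsometry_toLp_coeFn {Y : ℝ} (hY : 1 ≤ Y) {Ψ : ℝ → ℂ} (hΨ : Measurable Ψ)
    (hΨ2 : MemLp Ψ 2 ((volume : Measure ℝ).restrict (Ioi (Real.log Y)))) :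
    (cuspIsometry hΓ hneg hd hF σ hper hY (hΨ2.toLp Ψ) : ℍ → ℂ) =ᵐ[volume.restrict F] cuspLift Γ σ Y Ψ :=
  (cuspIsometry_coeFn hΓ hneg hd hF σ hper hY _).trans
    (cuspLift_ae_eq_of_ae_eq hΓ hneg hd hF σ hper hY (Lp.stronglyMeasurable _).measurable hΨ hΨ2.coeFn_toLp)

end Isometry

/-! ## 4. Unfolding against `L²` functions: the adjoint of the cusp isometry -/

section Adjoint

open _root_.MeasureTheory _root_.Set _root_.Filter
open scoped _root_.Pointwise _root_.ENNReal _root_.Topology _root_.ComplexConjugate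

/-- **The log-height constant term** of `G` at the cusp `𝔞 = σ∞`:
`(C_𝔞 G)(v) = e^{-v/2} ∫_0^1 G(σ(x + i e^v)) dx` — the profile `Ψ` with `√y Ψ(log y) = G_𝔞(y)`.
[cite: Iwaniec2002, §3.1 (3.2) & Lemma 3.3 (3.14), PDF pp. 40–41, 44] -/
def logCuspMean (σ : SL(2, ℝ)) (G : ℍ → ℂ) (v : ℝ) : ℂ :=
  ((Real.exp (-(v / 2)) : ℝ) : ℂ) * cuspMeanAt σ G (UpperHalfPlane.ofComplex ⟨0, Real.exp v⟩)

variable {F : Set ℍ}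
variable (hΓ : Γ ≤ (Matrix.SpecialLinearGroup.toGL : SL(2, ℝ) →* GL (Fin 2) ℝ).range)
  (hneg : (-1 : GL (Fin 2) ℝ) ∈ Γ) (hd : IsDiscreteSubgroup Γ) (hF : IsHypFundamentalDomain Γ F)
  (σ : SL(2, ℝ))
  (hper : (ConjAct.toConjAct (Matrix.SpecialLinearGroup.toGL σ : GL (Fin 2) ℝ)⁻¹ • Γ).strictPeriods =
    AddSubgroup.zmultiples 1)

include hΓ hneg hd hF hper in
/-- **Frame strip mass for one cusp**: `∫_{P(Y)} |g^Γ(σ v)|² dμ(v) ≤ ∫_F |g|²` for `Y ≥ 1`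
(the strip `σP(1)` has multiplicity `≤ 2`; the one-cusp case of
`Fuchsian.lintegral_sq_autExt_frameStrip_le`). [cite: Iwaniec2002, §2.2 (2.3)–(2.5), PDF pp. 30–31] -/
theorem lintegral_sq_autExt_cuspStrip_le {Y : ℝ} (hY : 1 ≤ Y) {g : ℍ → ℂ}
    (hg : AEStronglyMeasurable g (volume.restrict F)) :
    ∫⁻ v in cuspStrip Y, ‖autExt Γ F g (σ • v)‖ₑ ^ 2 ≤ ∫⁻ w in F, ‖g w‖ₑ ^ 2 := by
  have h := lintegral_sq_autExt_frameStrip_le (h := 1) (𝔞 := fun _ =>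
      (Matrix.SpecialLinearGroup.toGL σ : GL (Fin 2) ℝ) • (OnePoint.infty : OnePoint ℝ))
    (σ := fun _ => σ) hΓ hneg hd hF (fun _ => rfl) (fun _ => hper)
    (fun i j _ _ _ => Subsingleton.elim i j) 0 (measurableSet_cuspStrip Y) 0
    (fun v hv => ⟨by simpa using hv.1, by simpa using hv.2.1, lt_of_le_of_lt hY hv.2.2⟩) hg
  exact h

include hΓ hneg hd hF hper in
/-- `v ↦ g^Γ(σ v)` is square-integrable on the strip `P(Y)`, `Y ≥ 1`, for `g ∈ L²(F)`. [folklore] -/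
theorem memLp_autExt_comp_smul_cuspStrip {Y : ℝ} (hY : 1 ≤ Y) {g : ℍ → ℂ} (hg : MemLp g 2 (volume.restrict F)) :
    MemLp (fun v : ℍ => autExt Γ F g (σ • v)) 2 (volume.restrict (cuspStrip Y)) := by
  refine memLp_two_of_lintegral_enorm_sq_ne_top ?_ ?_
  · exact (aestronglyMeasurable_comp_sl_smul (aestronglyMeasurable_autExt hΓ hneg hd hF hg.1) σ).restrict
  · exact (lt_of_le_of_lt (lintegral_sq_autExt_cuspStrip_le hΓ hneg hd hF σ hper hY hg.1)
      (lintegral_enorm_sq_lt_top hg)).ne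

/-- `w ↦ φ(Im w)` is square-integrable on the strip `P(Y)` when `∫ |φ|² y⁻² < ∞`. [folklore] -/
theorem memLp_comp_im_cuspStrip {Y : ℝ} (hY : 0 ≤ Y) {φ : ℝ → ℂ} (hφm : Measurable φ)
    (hφ : ∫⁻ y in Ioi (0 : ℝ), ‖φ y‖ₑ ^ 2 * ENNReal.ofReal ((y ^ 2)⁻¹) ≠ ⊤) :
    MemLp (fun w : ℍ => φ w.im) 2 (volume.restrict (cuspStrip Y)) := by
  refine memLp_two_of_lintegral_enorm_sq_ne_top
    (hφm.comp UpperHalfPlane.continuous_im.measurable).aestronglyMeasurable.restrict ?_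
  refine (lt_of_le_of_lt ?_ (lt_top_iff_ne_top.mpr hφ)).ne
  calc ∫⁻ w in cuspStrip Y, ‖φ w.im‖ₑ ^ 2 ≤ ∫⁻ w in cuspStrip 0, ‖φ w.im‖ₑ ^ 2 :=
        lintegral_mono_set fun w hw => ⟨hw.1, hw.2.1, lt_of_le_of_lt hY hw.2.2⟩
    _ = _ := lintegral_cuspStrip_comp_im (fun y => ‖φ y‖ₑ ^ 2) (hφm.enorm.pow_const 2)

include hΓ hneg hd hF hper in
/-- **Integrability of the strip function** `w ↦ 𝟙_P(w) φ(Im w) g^Γ(σ w)` for `∫ |φ|² y⁻² < ∞`,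
`φ = 0` on `(-∞, Y]` (`Y ≥ 1`) and `g ∈ L²(F)` (Cauchy–Schwarz on the strip `P(Y)`, where `g^Γ ∘ σ`
carries at most the mass of `F`). [cite: Iwaniec2002, Lemma 3.3 (proof), PDF p. 44] -/
theorem integrable_strip_mul_of_memLp {Y : ℝ} (hY : 1 ≤ Y) {φ : ℝ → ℂ} (hφm : Measurable φ)
    (hφY : ∀ t ≤ Y, φ t = 0) (hφ : ∫⁻ y in Ioi (0 : ℝ), ‖φ y‖ₑ ^ 2 * ENNReal.ofReal ((y ^ 2)⁻¹) ≠ ⊤)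
    {g : ℍ → ℂ} (hg : MemLp g 2 (volume.restrict F)) :
    Integrable fun w : ℍ => (cuspStrip 0).indicator (fun _ => (1 : ℂ)) w *
      (φ w.im * autExt Γ F g (σ • w)) := by
  have h1 : Integrable (fun w : ℍ => φ w.im * autExt Γ F g (σ • w)) (volume.restrict (cuspStrip Y)) :=
    (memLp_comp_im_cuspStrip (by linarith) hφm hφ).integrable_mul
      (memLp_autExt_comp_smul_cuspStrip hΓ hneg hd hF σ hper hY hg)
  have h1' : Integrable ((cuspStrip Y).indicator fun w : ℍ => φ w.im * autExt Γ F g (σ • w)) :=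
    (integrable_indicator_iff (measurableSet_cuspStrip Y)).mpr h1
  refine h1'.congr (Eventually.of_forall fun w => ?_)
  change _ = (cuspStrip 0).indicator (fun _ => (1 : ℂ)) w * (φ w.im * autExt Γ F g (σ • w))
  by_cases hw : w ∈ cuspStrip Y
  · rw [indicator_of_mem hw, indicator_of_mem (show w ∈ cuspStrip 0 from ⟨hw.1, hw.2.1, w.im_pos⟩), one_mul]
  · rw [indicator_of_notMem hw]
    by_cases hw0 : w ∈ cuspStrip 0
    · have hle : w.im ≤ Y := by
        by_contra hlt
        exact hw ⟨hw0.1, hw0.2.1, not_le.mp hlt⟩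
      rw [hφY _ hle]; simp
    · rw [indicator_of_notMem hw0, zero_mul]

include hΓ hneg hd hF hper in
/-- **Lemma 3.3 for `L²` data** (unfolding): for `Y ≥ 1`, `φ` measurable with `φ = 0` on `(-∞, Y]`
and `∫ |φ|² y⁻² < ∞`, and `g ∈ L²(F)`,
`∫_F E_𝔞(z|φ) g(z) dμ(z) = ∫_0^∞ φ(y) y⁻² (g^Γ)_𝔞(y) dy` with `(g^Γ)_𝔞` the constant term of the
automorphic extension at `𝔞`. [cite: Iwaniec2002, Lemma 3.3 (3.14), PDF p. 44] -/
theorem setIntegral_incEisCusp_mul_of_memLp {Y : ℝ} (hY : 1 ≤ Y) {φ : ℝ → ℂ} (hφm : Measurable φ)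
    (hφY : ∀ t ≤ Y, φ t = 0) (hφ : ∫⁻ y in Ioi (0 : ℝ), ‖φ y‖ₑ ^ 2 * ENNReal.ofReal ((y ^ 2)⁻¹) ≠ ⊤)
    {g : ℍ → ℂ} (hg : MemLp g 2 (volume.restrict F)) :
    ∫ z in F, incEisCusp Γ σ φ z * g z =
      ∫ y in Ioi (0 : ℝ), (φ y * (((y ^ 2)⁻¹ : ℝ) : ℂ)) *
        cuspMeanAt σ (autExt Γ F g) (UpperHalfPlane.ofComplex ⟨0, y⟩) := by
  set G : ℍ → ℂ := autExt Γ F g with hG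
  have hGa : IsAutomorphic Γ G := isAutomorphic_autExt g
  -- replace `g` by `G` on `F`
  have e0 : ∫ z in F, incEisCusp Γ σ φ z * g z = ∫ z in F, incEisCusp Γ σ φ z * G z := by
    refine integral_congr_ae ?_
    filter_upwards [autExt_ae_eq_restrict hΓ hneg hd hF g] with z hz
    rw [hG, hz]
  rw [e0]
  set G' : ℍ → ℂ := fun v => G (σ • v) with hG'
  set Φ₀ : ℍ → ℂ := fun w => (cuspStrip 0).indicator (fun _ => (1 : ℂ)) w * (φ w.im * G' w) with hΦ₀
  have hΦ₀i : Integrable Φ₀ := integrable_strip_mul_of_memLp hΓ hneg hd hF σ hper hY hφm hφY hφ hg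
  set Φ : ℍ → ℂ := fun v => Φ₀ (σ⁻¹ • v) with hΦ
  have hΦi : Integrable Φ := integrable_comp_sl_inv_smul hΦ₀i σ
  have hunf := setIntegral_tsum_smul_eq hΓ hneg hd.countable hF hΦi
  have hpt : ∀ z : ℍ, incEisCusp Γ σ φ z * G z = (1 / 2) * ∑' γ : Γ, Φ ((γ : GL (Fin 2) ℝ) • z) := by
    intro z
    have h := tsum_strip_smul_eq_cusp hΓ hd σ hper φ hGa z
    have e : (fun γ : Γ => Φ ((γ : GL (Fin 2) ℝ) • z)) = fun γ : Γ =>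
        (cuspStrip 0).indicator (fun _ => (1 : ℂ)) (σ⁻¹ • (γ : GL (Fin 2) ℝ) • z) *
          (φ (σ⁻¹ • (γ : GL (Fin 2) ℝ) • z).im * G ((γ : GL (Fin 2) ℝ) • z)) := by
      funext γ
      simp only [hΦ, hΦ₀, hG', smul_inv_smul]
    rw [e, h]; ring
  simp_rw [hpt]
  -- the strip integrand is integrable (transport of `Φ₀`)
  have hint : IntegrableOn (stripIntegrand φ G') {z : ℂ | 0 < z.im} := by
    have h := (integrable_upperHalfPlane_iff_integrableOn_complex Φ₀).mp hΦ₀i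
    refine h.congr_fun (fun z hz => ?_) UpperHalfPlane.isOpen_upperHalfPlaneSet.measurableSet
    exact (stripIntegrand_eq φ G' hz).symm
  rw [integral_const_mul, hunf, hΦ, integral_comp_sl_inv_smul Φ₀ σ, hΦ₀,
    integral_strip_mul_eq_of_integrable hint]
  rw [show (1 / 2 : ℂ) * (2 * _) = _ from by ring]
  rfl

/-! ### Periodicity and continuity of constant terms; vanishing from orthogonality -/

omit hΓ hneg hd hF in
include hper in
/-- `v ↦ G(σ v)` is `1`-periodic for `Γ`-automorphic `G` (width one at `𝔞`). [cite: Iwaniec2002, §3.1 (3.1)–(3.2), PDF pp. 40–41] -/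
theorem comp_smul_vadd_one {G : ℍ → ℂ} (hGa : IsAutomorphic Γ G) (z : ℍ) : G (σ • ((1 : ℝ) +ᵥ z)) = G (σ • z) := by
  set S : GL (Fin 2) ℝ := Matrix.SpecialLinearGroup.toGL σ with hS
  have hT : Matrix.GeneralLinearGroup.upperRightHom (1 : ℝ) ∈ ConjAct.toConjAct S⁻¹ • Γ :=
    upperRightHom_one_mem_of_periods hper
  have hmem : S * Matrix.GeneralLinearGroup.upperRightHom (1 : ℝ) * S⁻¹ ∈ Γ := (mem_conj_inv_iff S _).mp hT
  have e : σ • ((1 : ℝ) +ᵥ z) = (S * Matrix.GeneralLinearGroup.upperRightHom (1 : ℝ) * S⁻¹) • (σ • z) := by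
    rw [mul_smul, mul_smul, ← toGL_smul_eq σ z, ← hS, inv_smul_smul, upperRightHom_smul, toGL_smul_eq]
  rw [e, hGa _ hmem]

/-- `Re w +ᵥ (i Im w) = w`. [folklore] -/
theorem re_vadd_ofComplex_im (w : ℍ) : w.re +ᵥ UpperHalfPlane.ofComplex ⟨0, w.im⟩ = w := by
  have h : UpperHalfPlane.ofComplex (⟨0, w.im⟩ : ℂ) = ⟨⟨0, w.im⟩, w.im_pos⟩ :=
    UpperHalfPlane.ofComplex_apply_of_im_pos (z := (⟨0, w.im⟩ : ℂ)) w.im_pos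
  rw [h]
  apply UpperHalfPlane.ext
  rw [UpperHalfPlane.coe_vadd]
  apply Complex.ext <;> simp

omit hΓ hneg hd hF in
include hper in
/-- **The constant term depends only on the height**: `G_𝔞(w) = G_𝔞(i Im w)` for automorphic `G`.
[cite: Iwaniec2002, §3.1 (3.2), PDF pp. 40–41] -/
theorem cuspMeanAt_eq_of_im {G : ℍ → ℂ} (hGa : IsAutomorphic Γ G) (w : ℍ) :
    cuspMeanAt σ G w = cuspMeanAt σ G (UpperHalfPlane.ofComplex ⟨0, w.im⟩) := by
  unfold cuspMeanAt
  conv_lhs => rw [← re_vadd_ofComplex_im w]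
  exact cuspMean_vadd (fun z => comp_smul_vadd_one σ hper hGa z) w.re _

/-- The horocycle point `x + i e^v` as a continuous function of `(v, x)`. [folklore] -/
theorem continuous_pt_exp : Continuous fun p : ℝ × ℝ => pt p.2 (Real.exp p.1) := by
  have h : (fun p : ℝ × ℝ => pt p.2 (Real.exp p.1)) =
      fun p : ℝ × ℝ => (⟨⟨p.2, Real.exp p.1⟩, by simpa using Real.exp_pos p.1⟩ : ℍ) := by
    funext p; exact pt_eq (Real.exp_pos p.1)
  rw [h]
  have hc : Continuous fun p : ℝ × ℝ => (⟨p.2, Real.exp p.1⟩ : ℂ) :=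
    Complex.equivRealProdCLM.symm.continuous.comp (continuous_snd.prodMk (Real.continuous_exp.comp continuous_fst))
  exact UpperHalfPlane.isEmbedding_coe.continuous_iff.mpr hc

/-- **Continuity of the constant term in the height** (log scale): for continuous `G`,
`v ↦ ∫_0^1 G(σ(x + i e^v)) dx` is continuous. [cite: Iwaniec2002, §3.1 (3.2), PDF pp. 40–41] -/
theorem continuous_cuspMeanAt_exp {G : ℍ → ℂ} (hGc : Continuous G) :
    Continuous fun v : ℝ => cuspMeanAt σ G (UpperHalfPlane.ofComplex ⟨0, Real.exp v⟩) := by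
  have e : (fun v : ℝ => cuspMeanAt σ G (UpperHalfPlane.ofComplex ⟨0, Real.exp v⟩)) =
      fun v : ℝ => ∫ x in (0 : ℝ)..1, G (σ • pt x (Real.exp v)) := by
    funext v
    rw [cuspMeanAt_apply]
    refine intervalIntegral.integral_congr fun x _ => ?_
    have hv := Real.exp_pos v
    congr 2
    rw [show UpperHalfPlane.ofComplex (⟨0, Real.exp v⟩ : ℂ) = pt 0 (Real.exp v) from rfl]
    apply UpperHalfPlane.ext
    rw [UpperHalfPlane.coe_vadd, coe_pt hv, coe_pt hv]
    apply Complex.ext <;> simp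
  rw [e]
  have hunc : Continuous (Function.uncurry fun (v : ℝ) (x : ℝ) => G (σ • pt x (Real.exp v))) :=
    hGc.comp ((continuous_const_smul σ).comp continuous_pt_exp)
  exact intervalIntegral.continuous_parametric_intervalIntegral_of_continuous' hunc 0 1

include hΓ hneg hd hF hper in
/-- **Vanishing of the constant term from orthogonality to incomplete Eisenstein series.** Let
`Y ≥ 1` and `G` be continuous and `Γ`-automorphic with `∫_F E_𝔞(z|φ) G(z) dμ = 0` for every real
continuous `φ` with compact support in `(Y, ∞)`. Then `G_𝔞(w) = 0` whenever `Im w > Y`. (Unfolding,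
Lemma 3.3, gives `∫ φ(y) y⁻² G_𝔞(y) dy = 0`, and `G_𝔞` is continuous.) This is the pointwise form of
"the truncated function has vanishing constant terms above `Y`" used for the compact part of the
kernel. [cite: Iwaniec2002, Lemma 3.3 (3.14)–(3.15) & §6.4 (6.29), PDF pp. 44, 88] -/
theorem cuspMeanAt_eq_zero_of_orthogonal {Y : ℝ} (hY : 1 ≤ Y) {G : ℍ → ℂ} (hGc : Continuous G)
    (hGa : IsAutomorphic Γ G)
    (horth : ∀ φ : ℝ → ℝ, Continuous φ → HasCompactSupport φ → tsupport φ ⊆ Ioi Y →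
      ∫ z in F, incEisCusp Γ σ (fun y => (φ y : ℂ)) z * G z = 0)
    {w : ℍ} (hw : Y < w.im) : cuspMeanAt σ G w = 0 := by
  have hY0 : 0 < Y := by linarith
  -- the constant term on the log scale
  set C : ℝ → ℂ := fun v => cuspMeanAt σ G (UpperHalfPlane.ofComplex ⟨0, Real.exp v⟩) with hC
  have hCc : Continuous C := continuous_cuspMeanAt_exp σ hGc
  -- orthogonality to smooth test functions on `(log Y, ∞)`
  have hC0 : ∀ᵐ v : ℝ, v ∈ Ioi (Real.log Y) → C v = 0 := by
    refine isOpen_Ioi.ae_eq_zero_of_integral_contDiff_smul_eq_zero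
      ((hCc.locallyIntegrable (μ := volume)).locallyIntegrableOn (Ioi (Real.log Y))) fun Ψ hΨ hΨs hΨU => ?_
    -- the profile `φ(y) = y Ψ(log y)` on `(0, ∞)`
    set φ : ℝ → ℝ := fun y => if 0 < y then y * Ψ (Real.log y) else 0 with hφ
    obtain ⟨a, ha⟩ : ∃ a, Real.log Y < a ∧ ∀ v, Ψ v ≠ 0 → a ≤ v := by
      by_cases hne : (tsupport Ψ).Nonempty
      · obtain ⟨a, ha, hamin⟩ := hΨs.isCompact.exists_isLeast hne
        exact ⟨a, hΨU ha, fun v hv => hamin (subset_tsupport _ hv)⟩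
      · refine ⟨Real.log Y + 1, by linarith, fun v hv => ?_⟩
        exact absurd ⟨v, subset_tsupport _ hv⟩ hne
    have hφlow : ∀ y < Real.exp a, φ y = 0 := by
      intro y hy
      simp only [hφ]
      split_ifs with hy0
      · have : Ψ (Real.log y) = 0 := by
          by_contra hne
          have := ha.2 _ hne
          have : Real.exp a ≤ y := by rw [← Real.exp_log hy0]; exact Real.exp_le_exp.mpr this
          linarith
        rw [this, mul_zero]
      · rfl
    have hφc : Continuous φ := by
      refine continuous_iff_continuousAt.mpr fun y => ?_
      by_cases hy : 0 < y
      · have hev : φ =ᶠ[𝓝 y] fun y => y * Ψ (Real.log y) := by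
          filter_upwards [lt_mem_nhds hy] with t ht
          simp only [hφ, if_pos ht]
        refine (ContinuousAt.congr ?_ hev.symm)
        exact continuousAt_id.mul (hΨ.continuous.continuousAt.comp (Real.continuousAt_log hy.ne'))
      · have hev : φ =ᶠ[𝓝 y] fun _ => 0 := by
          have hlt : y < Real.exp a := lt_of_le_of_lt (not_lt.mp hy) (Real.exp_pos a)
          filter_upwards [gt_mem_nhds hlt] with t ht
          exact hφlow t ht
        exact (continuousAt_const.congr hev.symm)
    obtain ⟨b, hb⟩ : ∃ b, ∀ v, Ψ v ≠ 0 → v ≤ b := by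
      obtain ⟨b, hb⟩ := hΨs.isCompact.isBounded.subset_closedBall 0
      refine ⟨b, fun v hv => ?_⟩
      have := hb (subset_tsupport _ hv)
      rw [Metric.mem_closedBall, dist_zero_right, Real.norm_eq_abs] at this
      exact (le_abs_self v).trans this
    have hφhigh : ∀ y > Real.exp b, φ y = 0 := by
      intro y hy
      have hy0 : 0 < y := (Real.exp_pos b).trans hy
      simp only [hφ, if_pos hy0]
      have : Ψ (Real.log y) = 0 := by
        by_contra hne
        have := hb _ hne
        have : y ≤ Real.exp b := by rw [← Real.exp_log hy0]; exact Real.exp_le_exp.mpr this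
        linarith
      rw [this, mul_zero]
    have hφsupp : HasCompactSupport φ := by
      refine HasCompactSupport.of_support_subset_isCompact (isCompact_Icc (a := Real.exp a) (b := Real.exp b)) ?_
      intro y hy
      rw [Function.mem_support] at hy
      constructor
      · by_contra h; exact hy (hφlow y (not_le.mp h))
      · by_contra h; exact hy (hφhigh y (not_le.mp h))
    have hφU : tsupport φ ⊆ Ioi Y := by
      have h1 : tsupport φ ⊆ Icc (Real.exp a) (Real.exp b) :=
        closure_minimal (fun y hy => by
          rw [Function.mem_support] at hy
          exact ⟨by by_contra h; exact hy (hφlow y (not_le.mp h)),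
            by by_contra h; exact hy (hφhigh y (not_le.mp h))⟩) isClosed_Icc
      intro y hy
      have := (h1 hy).1
      have hYa : Y < Real.exp a := by rw [← Real.exp_log hY0]; exact Real.exp_lt_exp.mpr ha.1
      exact lt_of_lt_of_le hYa this
    -- unfolding
    have hunf := setIntegral_incEisCusp_mul hΓ hneg hd hF σ hper (ψ := fun y => (φ y : ℂ))
      (Complex.continuous_ofReal.comp hφc) (b := Real.exp b) (Real.exp_pos a)
      (fun t ht => by simp [hφlow t ht]) (fun t ht => by simp [hφhigh t ht]) hGa hGc
    rw [horth φ hφc hφsupp hφU] at hunf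
    -- substitute `y = e^v`
    have hsub := integral_Ioi_expSubst one_pos
      (fun y : ℝ => ((φ y : ℂ) * (((y ^ 2)⁻¹ : ℝ) : ℂ)) * cuspMeanAt σ G (UpperHalfPlane.ofComplex ⟨0, y⟩))
    rw [hsub] at hunf
    have e : ∀ v : ℝ, (1 * Real.exp v) • ((((φ (1 * Real.exp v)) : ℂ) * ((((1 * Real.exp v) ^ 2)⁻¹ : ℝ) : ℂ)) *
        cuspMeanAt σ G (UpperHalfPlane.ofComplex ⟨0, 1 * Real.exp v⟩)) = Ψ v • C v := by
      intro v
      rw [one_mul]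
      have hv := Real.exp_pos v
      simp only [hφ, if_pos hv, Real.log_exp, hC, Complex.real_smul]
      have hexp : (Real.exp v : ℂ) ≠ 0 := by exact_mod_cast hv.ne'
      push_cast
      field_simp
    simp_rw [e] at hunf
    exact hunf.symm
  -- continuity upgrades a.e. to everywhere on `(log Y, ∞)`
  have hCzero : ∀ v, Real.log Y < v → C v = 0 := by
    intro v hv
    have hopen : IsOpen (Ioi (Real.log Y)) := isOpen_Ioi
    by_contra hne
    have hpos : 0 < volume ({u : ℝ | C u ≠ 0} ∩ Ioi (Real.log Y)) := by
      have ho : IsOpen ({u : ℝ | C u ≠ 0} ∩ Ioi (Real.log Y)) :=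
        (isOpen_ne_fun hCc continuous_const).inter hopen
      exact ho.measure_pos volume ⟨v, hne, hv⟩
    have hzero : volume ({u : ℝ | C u ≠ 0} ∩ Ioi (Real.log Y)) = 0 := by
      rw [measure_eq_zero_iff_ae_notMem]
      filter_upwards [hC0] with u hu hmem
      exact hmem.1 (hu hmem.2)
    rw [hzero] at hpos
    exact lt_irrefl _ hpos
  -- back to `w`
  rw [cuspMeanAt_eq_of_im σ hper hGa w]
  have h := hCzero (Real.log w.im) (Real.log_lt_log hY0 hw)
  simp only [hC, Real.exp_log w.im_pos] at h
  exact h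

end Adjoint

/-! ## 5. Several cusps: orthogonality of the cusp lifts; the bridge `E_𝔞(·|φ) = V_𝔞Ψ_φ` -/

section System

open _root_.MeasureTheory _root_.Set _root_.Filter
open scoped _root_.Pointwise _root_.ENNReal _root_.Topology _root_.ComplexConjugate _root_.InnerProductSpace

variable {F : Set ℍ} {h : ℕ} {𝔞 : Fin h → OnePoint ℝ} {σ : Fin h → SL(2, ℝ)}
variable (hΓ : Γ ≤ (Matrix.SpecialLinearGroup.toGL : SL(2, ℝ) →* GL (Fin 2) ℝ).range)
  (hneg : (-1 : GL (Fin 2) ℝ) ∈ Γ) (hd : IsDiscreteSubgroup Γ) (hF : IsHypFundamentalDomain Γ F)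
  (hinfty : ∀ i, (Matrix.SpecialLinearGroup.toGL (σ i) : GL (Fin 2) ℝ) • (OnePoint.infty : OnePoint ℝ) = 𝔞 i)
  (hper : ∀ i, (ConjAct.toConjAct (Matrix.SpecialLinearGroup.toGL (σ i) : GL (Fin 2) ℝ)⁻¹ • Γ).strictPeriods =
    AddSubgroup.zmultiples 1)
  (hineq : ∀ i j, ∀ γ ∈ Γ, γ • 𝔞 i = 𝔞 j → i = j)

include hΓ in
/-- **Where `E_𝔞(z|ψ) ≠ 0` the point lies in the zone**: if `ψ = 0` on `(-∞, Y]` and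
`E_𝔞(z|ψ) ≠ 0` then `z = γσu` with `γ ∈ Γ`, `Im u > Y`. [cite: Iwaniec2002, §3.2 (3.12) & (3.16), PDF pp. 43–44] -/
theorem exists_smul_eq_of_incEisCusp_ne_zero (s : SL(2, ℝ)) {Y : ℝ} {ψ : ℝ → ℂ}
    (hψ : ∀ t ≤ Y, ψ t = 0) {z : ℍ} (hz : incEisCusp Γ s ψ z ≠ 0) :
    ∃ γ ∈ Γ, ∃ u : ℍ, Y < u.im ∧ z = γ • s • u := by
  set S : GL (Fin 2) ℝ := Matrix.SpecialLinearGroup.toGL s with hS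
  set Γ' : Subgroup (GL (Fin 2) ℝ) := ConjAct.toConjAct S⁻¹ • Γ with hΓ'
  have hΓ'le : Γ' ≤ (Matrix.SpecialLinearGroup.toGL : SL(2, ℝ) →* GL (Fin 2) ℝ).range := by
    rw [hΓ', hS, ← map_inv]; exact conj_le_range hΓ s⁻¹
  -- some row contributes
  have hex : ∃ r : rows Γ', ψ (rowIm r.1 (s⁻¹ • z)) ≠ 0 := by
    by_contra hall
    push Not at hall
    apply hz
    show incEis Γ' ψ (s⁻¹ • z) = 0
    unfold incEis
    rw [show (fun r : rows Γ' => ψ (rowIm r.1 (s⁻¹ • z))) = fun _ => 0 from funext hall, tsum_zero, mul_zero]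
  obtain ⟨⟨r, γ', hγ', rfl⟩, hr⟩ := hex
  have hY : Y < rowIm (((γ' : GL (Fin 2) ℝ) : Matrix (Fin 2) (Fin 2) ℝ) 1) (s⁻¹ • z) := by
    by_contra hle; exact hr (hψ _ (not_lt.mp hle))
  rw [← im_smul_eq_rowIm (hΓ'le hγ')] at hY
  have hδ : S * γ' * S⁻¹ ∈ Γ := (mem_conj_inv_iff S γ').mp hγ'
  refine ⟨(S * γ' * S⁻¹)⁻¹, Γ.inv_mem hδ, γ' • s⁻¹ • z, hY, ?_⟩
  have e1 : s⁻¹ • z = S⁻¹ • z := by rw [hS, ← map_inv]; rfl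
  rw [← toGL_smul_eq s, ← hS, e1]
  simp only [_root_.mul_inv_rev, inv_inv, mul_smul, inv_smul_smul, smul_inv_smul]

include hΓ hd hinfty hper hineq in
/-- **Cusp lifts at inequivalent cusps have disjoint supports**: for `k ≠ j` and `Y ≥ 1`,
`(V_𝔞ₖΨ)(z) · (V_𝔞ⱼΨ')(z) = 0` at every `z`. [cite: Iwaniec2002, §2.2 (2.3)–(2.5) & §3.2, PDF pp. 30–31, 43] -/
theorem cuspLift_mul_cuspLift_eq_zero_of_ne {k j : Fin h} (hkj : k ≠ j) {Y : ℝ} (hY : 1 ≤ Y)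
    (Ψ Ψ' : ℝ → ℂ) (z : ℍ) : cuspLift Γ (σ k) Y Ψ z * cuspLift Γ (σ j) Y Ψ' z = 0 := by
  by_cases hz : cuspLift Γ (σ j) Y Ψ' z = 0
  · rw [hz, mul_zero]
  · obtain ⟨γ, hγ, u, hu, rfl⟩ := exists_smul_eq_of_incEisCusp_ne_zero hΓ (σ j)
      (fun _ ht => liftProfile_eq_zero_of_le Ψ' ht) hz
    have h0 : cuspLift Γ (σ k) Y Ψ (γ • σ j • u) = 0 := by
      unfold cuspLift
      rw [incEisCusp_smul hΓ (σ k) _ hγ]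
      refine incEisCusp_frame_eq_zero_of_ne hΓ hd hinfty hper hineq hkj
        (fun _ ht => liftProfile_eq_zero_of_le Ψ ht) ?_
      have hu0 := u.im_pos
      rw [div_le_iff₀ hu0]
      nlinarith
    rw [h0, zero_mul]

include hΓ hneg hd hF hinfty hper hineq in
/-- **The cusp isometries of inequivalent cusps have orthogonal ranges** (`Y ≥ 1`).
[cite: Iwaniec2002, §2.2 (2.3)–(2.5) & §7.3 (orthogonality of the `𝓔_𝔞`), PDF pp. 30–31, 75] -/
theorem inner_cuspIsometry_eq_zero_of_ne {k j : Fin h} (hkj : k ≠ j) {Y : ℝ} (hY : 1 ≤ Y)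
    (f g : Lp ℂ 2 ((volume : Measure ℝ).restrict (Ioi (Real.log Y)))) :
    ⟪cuspIsometry hΓ hneg hd hF (σ k) (hper k) hY f, cuspIsometry hΓ hneg hd hF (σ j) (hper j) hY g⟫_ℂ = 0 := by
  rw [L2.inner_def]
  refine integral_eq_zero_of_ae ?_
  filter_upwards [cuspIsometry_coeFn hΓ hneg hd hF (σ k) (hper k) hY f,
    cuspIsometry_coeFn hΓ hneg hd hF (σ j) (hper j) hY g] with z hz hz'
  rw [hz, hz', RCLike.inner_apply]
  have h := cuspLift_mul_cuspLift_eq_zero_of_ne hΓ hd hinfty hper hineq hkj hY (⇑f) (⇑g) z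
  rcases mul_eq_zero.mp h with h1 | h1
  · rw [h1, map_zero, mul_zero]; rfl
  · rw [h1, zero_mul]; rfl

/-- The log-profile of a height profile `φ`: `Ψ_φ(v) = e^{-v/2} φ(e^v)`. [cite: Iwaniec2002, §4.2 (4.12), PDF p. 51] -/
def logProfile (φ : ℝ → ℂ) (v : ℝ) : ℂ := ((Real.exp (-(v / 2)) : ℝ) : ℂ) * φ (Real.exp v)

/-- The lift of the log-profile of `φ` is `φ`, when `φ = 0` on `(-∞, Y]`, `Y > 0`. [folklore] -/
theorem liftProfile_logProfile {Y : ℝ} (hY : 0 < Y) {φ : ℝ → ℂ} (hφ : ∀ t ≤ Y, φ t = 0) :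
    liftProfile Y (logProfile φ) = φ := by
  funext y
  by_cases hy : Y < y
  · have hy0 : 0 < y := hY.trans hy
    rw [liftProfile_eq_of_lt _ hy, logProfile, Real.exp_log hy0, ← mul_assoc, ← Complex.ofReal_mul,
      show Real.sqrt y * Real.exp (-(Real.log y / 2)) = 1 by
        rw [Real.sqrt_eq_rpow, Real.rpow_def_of_pos hy0, ← Real.exp_add]; ring_nf; exact Real.exp_zero]
    simp
  · rw [liftProfile_eq_zero_of_le _ (not_lt.mp hy), hφ _ (not_lt.mp hy)]

/-- **Bridge**: `E_𝔞(·|φ) = V_𝔞(Ψ_φ)` for a height profile `φ` vanishing on `(-∞, Y]`, `Y > 0`. [cite: Iwaniec2002, §4.2 (4.12), PDF p. 51] -/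
theorem incEisCusp_eq_cuspLift (s : SL(2, ℝ)) {Y : ℝ} (hY : 0 < Y) {φ : ℝ → ℂ} (hφ : ∀ t ≤ Y, φ t = 0) :
    incEisCusp Γ s φ = cuspLift Γ s Y (logProfile φ) := by
  unfold cuspLift; rw [liftProfile_logProfile hY hφ]

/-- Measurability of the log-profile. [folklore] -/
theorem measurable_logProfile {φ : ℝ → ℂ} (hφ : Measurable φ) : Measurable (logProfile φ) :=
  (Complex.measurable_ofReal.comp (Real.measurable_exp.comp (measurable_id.div_const 2).neg)).mul
    (hφ.comp Real.measurable_exp)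

/-- Continuity of the log-profile. [folklore] -/
theorem continuous_logProfile {φ : ℝ → ℂ} (hφ : Continuous φ) : Continuous (logProfile φ) :=
  (Complex.continuous_ofReal.comp (Real.continuous_exp.comp (continuous_id.div_const 2).neg)).mul
    (hφ.comp Real.continuous_exp)

end System

end Fuchsian

end Literature.NumberTheory.Automorphic

end
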